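import Literature.NumberTheory.LFunctions.LandauGonekContour
import Literature.NumberTheory.LFunctions.ExplicitFormulaPsiProofs
import HarnessLib

/-!
# Landau's formula `∑_{|γ| ≤ T} x^ρ`: the far-left edge, the trivial zeros, the horizontal lines

Topic: `Literature/NumberTheory/LFunctions`. THEOREMS (everything proved). Second step of the proof
of Landau's formula over the zeros of `ζ` in the uniform (crude) form of Gonek 1993 Thm. 1
(`LandauGonekContour.lean` for the residues), for the weight `Φ(s) = x^s`, `x > 1`, and the integrand
`F_x(s) = (−ζ'/ζ)(s) x^s`:

* `rightEdge_identity_cpow` — letting `K → ∞` in `LandauGonek.contour_identity_entire` (the far-left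
  edge tends to `0`, `tendsto_farLeft_cpow`; `∑_{k≥1} x^{−2k} = 1/(x² − 1)`,
  `hasSum_trivialZero_cpow`): for a height `T ≥ 1` which is `±` no ordinate,
  `i ∫_{−T}^{T} F_x(b+it) dt = 2πi (x − ∑_{|Im ρ| ≤ T} m(ρ) x^ρ − 1/(x² − 1))
   − ∫_{−∞}^{b} F_x(σ − iT) dσ + ∫_{−∞}^{b} F_x(σ + iT) dσ`,
  given integrability on the two half-lines;
* `horizontal_integral_bound_cpow` — at a good height `|t| ≥ 2` (all ordinates `η`-away),
  `F_x` is integrable on `(−∞, 2] + it` and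
  `‖∫_{−∞}^{2} F_x(σ+it) dσ‖ ≤ x² (Λ₀/log x + 20/(e log² x))`,
  `Λ₀ = C_r + 17 + 2 log|t| + C_h log(|t|+4)/η + ∑ Λ(n) n^{−3/2}` (the tree's three bounds for
  `ζ'/ζ`: far left MV Lemma 12.4, good height MV Lemma 12.2, Dirichlet series on `σ ≥ 3/2`, as in
  `ExplicitPsi.horizontal_integral_bound`).

## References

* S. M. Gonek, *An explicit formula of Landau and its applications to the theory of the
  zeta-function*, Contemp. Math. 143 (1993), 395–413, Thm. 1 (proof). [Gonek1993]
* H. L. Montgomery, R. C. Vaughan, *Multiplicative Number Theory I*, CUP 2007, §12.1 (method).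
  [MontgomeryVaughan2007]
-/

noncomputable section

open Complex Filter Set MeasureTheory Topology intervalIntegral
open scoped Real Interval

namespace Literature.NumberTheory.LFunctions

namespace LandauGonek

open PsiOneExplicit ExplicitPsi

/-! ### The far-left edge and the trivial zeros -/

/-- **The far-left edge.** For `x > 1`, `T ≥ 1`: `∫_{-T}^{T} (−ζ'/ζ)(a_K+it) x^{a_K+it} dt → 0` as
`K → ∞`, `a_K = −2K − 1/2` (`|ζ'/ζ| ≤ C_r + 6K + 16 + 2log(1+T)` there and `|x^s| = x^{a_K}`;
`K x^{−2K} → 0`). [cite: Gonek1993, Thm. 1 (proof)] -/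
theorem tendsto_farLeft_cpow {x T : ℝ} (hx : 1 < x) (hT : 1 ≤ T) :
    Tendsto (fun K : ℕ ↦ ∫ t in (-T)..T,
      (fun s : ℂ ↦ (-deriv riemannZeta s / riemannZeta s) * (x : ℂ) ^ s)
        ((((-(2 * (K : ℝ)) - 1 / 2 : ℝ)) : ℂ) + t * I)) atTop (𝓝 0) := by
  have hx0 : 0 < x := by linarith
  have hT0 : 0 < T := by linarith
  obtain ⟨Cr, hCr0, hCr⟩ := ZetaZeroSum.exists_norm_logDeriv_riemannXi_le_of_re_ge
  set A : ℝ := Cr + 19 + 2 * Real.log (1 + T) with hA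
  have hlogT : 0 ≤ Real.log (1 + T) := Real.log_nonneg (by linarith)
  have hA0 : 0 ≤ A := by positivity
  set r : ℝ := (x ^ 2)⁻¹ with hr
  have hr0 : 0 ≤ r := by positivity
  have hr1 : r < 1 := inv_lt_one_of_one_lt₀ (by nlinarith)
  -- the bound `‖∫‖ ≤ A (2K + 1/2) x^{-1/2} r^K · 2T` for `K ≥ 1`
  have hbound : ∀ K : ℕ, 1 ≤ K → ‖∫ t in (-T)..T,
      (fun s : ℂ ↦ (-deriv riemannZeta s / riemannZeta s) * (x : ℂ) ^ s)
        ((((-(2 * (K : ℝ)) - 1 / 2 : ℝ)) : ℂ) + t * I)‖ ≤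
      A * (2 * K + 1 / 2) * x ^ (-(1 / 2) : ℝ) * r ^ K * (2 * T) := by
    intro K hK
    have hK1 : (1 : ℝ) ≤ K := by exact_mod_cast hK
    set a : ℝ := -(2 * (K : ℝ)) - 1 / 2 with ha
    have hxa : x ^ a = x ^ (-(1 / 2) : ℝ) * r ^ K := by
      have h1 : x ^ (-(2 * (K : ℝ))) = r ^ K := by
        rw [Real.rpow_neg hx0.le, Real.rpow_mul hx0.le, Real.rpow_two, Real.rpow_natCast, hr, inv_pow]
      rw [ha, show -(2 * (K : ℝ)) - 1 / 2 = -(1 / 2) + -(2 * (K : ℝ)) by ring, Real.rpow_add hx0, h1]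
    have hpt : ∀ t ∈ Ι (-T) T, ‖(fun s : ℂ ↦ (-deriv riemannZeta s / riemannZeta s) * (x : ℂ) ^ s)
        (((a : ℝ) : ℂ) + t * I)‖ ≤ A * (2 * K + 1 / 2) * x ^ (-(1 / 2) : ℝ) * r ^ K := by
      intro t ht
      have htT : |t| ≤ T := by
        rw [Set.mem_uIoc] at ht
        rcases ht with ⟨h1, h2⟩ | ⟨h1, h2⟩
        · exact abs_le.2 ⟨by linarith, h2⟩
        · linarith
      have h1 := norm_logDeriv_riemannZeta_farLeft_le hCr hK t
      rw [← ha] at h1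
      show ‖(-deriv riemannZeta (((a : ℝ) : ℂ) + t * I) / riemannZeta (((a : ℝ) : ℂ) + t * I)) *
        (x : ℂ) ^ (((a : ℝ) : ℂ) + t * I)‖ ≤ _
      rw [norm_mul, neg_div, norm_neg, Complex.norm_cpow_eq_rpow_re_of_pos hx0]
      have hre : ((((a : ℝ) : ℂ) + t * I)).re = a := by simp
      rw [hre]
      have hlog : Real.log (1 + |t|) ≤ Real.log (1 + T) :=
        Real.log_le_log (by positivity) (by linarith)
      have h1' : ‖deriv riemannZeta (((a : ℝ) : ℂ) + t * I) / riemannZeta (((a : ℝ) : ℂ) + t * I)‖ ≤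
          A * (2 * K + 1 / 2) := by
        refine (show _ ≤ Cr + 6 * K + 16 + 2 * Real.log (1 + |t|) from h1).trans ?_
        rw [hA]
        nlinarith
      calc ‖deriv riemannZeta (((a : ℝ) : ℂ) + t * I) / riemannZeta (((a : ℝ) : ℂ) + t * I)‖ * x ^ a
          ≤ (A * (2 * K + 1 / 2)) * x ^ a :=
            mul_le_mul_of_nonneg_right h1' (Real.rpow_nonneg hx0.le _)
        _ = A * (2 * K + 1 / 2) * x ^ (-(1 / 2) : ℝ) * r ^ K := by rw [hxa]; ring
    have h := intervalIntegral.norm_integral_le_of_norm_le_const hpt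
    rw [show |T - -T| = 2 * T by rw [sub_neg_eq_add, abs_of_nonneg (by linarith)]; ring] at h
    exact h
  have hlim : Tendsto (fun K : ℕ ↦ A * (2 * K + 1 / 2) * x ^ (-(1 / 2) : ℝ) * r ^ K * (2 * T))
      atTop (𝓝 0) := by
    have h1 := tendsto_self_mul_const_pow_of_lt_one hr0 hr1
    have h2 := tendsto_pow_atTop_nhds_zero_of_lt_one hr0 hr1
    have h3 : Tendsto (fun K : ℕ ↦ (2 * ((K : ℝ) * r ^ K) + 1 / 2 * r ^ K)) atTop (𝓝 (2 * 0 + 1 / 2 * 0)) :=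
      (h1.const_mul 2).add (h2.const_mul (1 / 2))
    rw [mul_zero, mul_zero, add_zero] at h3
    have h4 := (h3.const_mul (A * x ^ (-(1 / 2) : ℝ))).mul_const (2 * T)
    rw [mul_zero, zero_mul] at h4
    refine h4.congr fun K ↦ ?_
    ring
  refine squeeze_zero_norm' ?_ hlim
  filter_upwards [eventually_ge_atTop 1] with K hK using hbound K hK

/-- **The sum over the trivial zeros** (`x > 1`): `∑_{k≥0} x^{−2(k+1)} = 1/(x² − 1)`. [folklore] -/
theorem hasSum_trivialZero_cpow {x : ℝ} (hx : 1 < x) :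
    HasSum (fun k : ℕ ↦ (x : ℂ) ^ (-2 * ((k : ℂ) + 1))) ((((x ^ 2 - 1)⁻¹ : ℝ)) : ℂ) := by
  have hx0 : 0 < x := by linarith
  set r : ℝ := (x ^ 2)⁻¹ with hr
  have hx2 : 1 < x ^ 2 := by nlinarith
  have hr0 : 0 ≤ r := by positivity
  have hr1 : r < 1 := inv_lt_one_of_one_lt₀ hx2
  have h1 : HasSum (fun k : ℕ ↦ r ^ (k + 1)) (r * (1 - r)⁻¹) := by
    have h := (hasSum_geometric_of_lt_one hr0 hr1).mul_left r
    refine h.congr_fun fun k ↦ ?_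
    ring
  have hval : r * (1 - r)⁻¹ = (x ^ 2 - 1)⁻¹ := by
    have h2 : x ^ 2 - 1 ≠ 0 := by linarith
    have h3 : (1 : ℝ) - r ≠ 0 := by linarith
    have h4 : x ^ 2 ≠ 0 := by positivity
    rw [← div_eq_mul_inv, inv_eq_one_div, div_eq_div_iff h3 h2, hr, one_mul, mul_sub, mul_one,
      inv_mul_cancel₀ h4]
  rw [← hval]
  have h2 := Complex.hasSum_ofReal.2 h1
  refine h2.congr_fun fun k ↦ ?_
  exact cpow_trivialZero hx0 k

/-! ### The identity for the right edge: `K → ∞` -/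

/-- **The identity for the right edge** (Landau/Gonek, `K → ∞` in `contour_identity_entire`). Let
`x > 1`, `b > 1`, `δ` a gap for the ordinates, `T ≥ 1` a height which is `±` no ordinate, and assume
`F_x(s) = (−ζ'/ζ)(s) x^s` is integrable on the two half-lines `(−∞, b] ± iT`. Then
`i ∫_{-T}^{T} F_x(b+it) dt = 2πi (x − ∑_{|Im ρ| ≤ T} m(ρ) x^ρ − 1/(x² − 1))
  − ∫_{−∞}^{b} F_x(σ − iT) dσ + ∫_{−∞}^{b} F_x(σ + iT) dσ`. [cite: Gonek1993, Thm. 1 (proof)] -/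
theorem rightEdge_identity_cpow {x δ T b : ℝ} (hx : 1 < x) (hb : 1 < b) (hδ : 0 < δ)
    (hgap : ∀ ρ ∈ RHWave0.riemannZetaNontrivialZeros, 2 * δ ≤ |ρ.im|)
    (hT : 1 ≤ T) (hgood : ∀ ρ ∈ RHWave0.riemannZetaNontrivialZeros, ρ.im ≠ T ∧ ρ.im ≠ -T)
    (hint_top : IntegrableOn (fun σ : ℝ ↦
      (fun s : ℂ ↦ (-deriv riemannZeta s / riemannZeta s) * (x : ℂ) ^ s) ((σ : ℂ) + T * I)) (Iic b))
    (hint_bot : IntegrableOn (fun σ : ℝ ↦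
      (fun s : ℂ ↦ (-deriv riemannZeta s / riemannZeta s) * (x : ℂ) ^ s) ((σ : ℂ) + (-T : ℝ) * I))
      (Iic b)) :
    I * ∫ t in (-T)..T,
        (fun s : ℂ ↦ (-deriv riemannZeta s / riemannZeta s) * (x : ℂ) ^ s) ((b : ℂ) + t * I) =
      2 * π * I * ((x : ℂ) -
        ∑ ρ ∈ (weilZeroIndex_finite T).toFinset, (riemannZetaZeroOrder ρ : ℂ) * (x : ℂ) ^ ρ -
          ((((x ^ 2 - 1)⁻¹ : ℝ)) : ℂ)) -
      (∫ σ in Iic b,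
        (fun s : ℂ ↦ (-deriv riemannZeta s / riemannZeta s) * (x : ℂ) ^ s) ((σ : ℂ) + (-T : ℝ) * I)) +
      ∫ σ in Iic b,
        (fun s : ℂ ↦ (-deriv riemannZeta s / riemannZeta s) * (x : ℂ) ^ s) ((σ : ℂ) + T * I) := by
  have hx0 : 0 < x := by linarith
  set G : ℂ → ℂ := fun s ↦ (-deriv riemannZeta s / riemannZeta s) * (x : ℂ) ^ s with hG
  set a : ℕ → ℝ := fun K ↦ -(2 * (K : ℝ)) - 1 / 2 with ha
  set V : ℂ := ∫ t in (-T)..T, G ((b : ℂ) + t * I) with hV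
  set Res : ℂ := (x : ℂ) -
    ∑ ρ ∈ (weilZeroIndex_finite T).toFinset, (riemannZetaZeroOrder ρ : ℂ) * (x : ℂ) ^ ρ with hRes
  set Z : ℕ → ℂ := fun K ↦ ∑ k ∈ Finset.range K, (x : ℂ) ^ (-2 * ((k : ℂ) + 1)) with hZ
  set Hbot : ℕ → ℂ := fun K ↦ ∫ σ in (a K)..b, G ((σ : ℂ) + (-T : ℝ) * I) with hHbot
  set Htop : ℕ → ℂ := fun K ↦ ∫ σ in (a K)..b, G ((σ : ℂ) + T * I) with hHtop
  set Vleft : ℕ → ℂ := fun K ↦ ∫ t in (-T)..T, G (((a K : ℝ) : ℂ) + t * I) with hVleft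
  -- the identity at level `K`
  have hK : ∀ K : ℕ, 1 ≤ K → I * V = 2 * π * I * (Res - Z K) - Hbot K + Htop K + I * Vleft K := by
    intro K hK
    have h := contour_identity_entire (Φ := fun s : ℂ ↦ (x : ℂ) ^ s) (differentiable_const_cpow hx0)
      hb hδ hgap hT hgood hK
    rw [Literature.Analysis.Complex.rectBoundaryIntegral, cpow_one] at h
    have h' : Hbot K - Htop K + I * V - I * Vleft K = 2 * π * I * (Res - Z K) := by
      rw [hHbot, hHtop, hV, hVleft, hRes, hZ]
      simp only [ha]
      push_cast at h ⊢
      linear_combination h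
    linear_combination h'
  -- the limits
  have hlimZ : Tendsto Z atTop (𝓝 ((((x ^ 2 - 1)⁻¹ : ℝ)) : ℂ)) :=
    (hasSum_trivialZero_cpow hx).tendsto_sum_nat
  have hlimbot : Tendsto Hbot atTop (𝓝 (∫ σ in Iic b, G ((σ : ℂ) + (-T : ℝ) * I))) :=
    intervalIntegral_tendsto_integral_Iic b hint_bot tendsto_leftAbscissa
  have hlimtop : Tendsto Htop atTop (𝓝 (∫ σ in Iic b, G ((σ : ℂ) + T * I))) :=
    intervalIntegral_tendsto_integral_Iic b hint_top tendsto_leftAbscissa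
  have hlimleft : Tendsto Vleft atTop (𝓝 0) := tendsto_farLeft_cpow hx hT
  have hlim : Tendsto (fun K ↦ 2 * π * I * (Res - Z K) - Hbot K + Htop K + I * Vleft K) atTop
      (𝓝 (2 * π * I * (Res - ((((x ^ 2 - 1)⁻¹ : ℝ)) : ℂ)) -
        (∫ σ in Iic b, G ((σ : ℂ) + (-T : ℝ) * I)) + (∫ σ in Iic b, G ((σ : ℂ) + T * I)) + I * 0)) :=
    ((((hlimZ.const_sub Res).const_mul (2 * π * I)).sub hlimbot).add hlimtop).add
      (hlimleft.const_mul I)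
  rw [mul_zero, add_zero] at hlim
  have hconst : Tendsto (fun _ : ℕ ↦ I * V) atTop (𝓝 (I * V)) := tendsto_const_nhds
  have heq : (fun K ↦ 2 * π * I * (Res - Z K) - Hbot K + Htop K + I * Vleft K) =ᶠ[atTop]
      fun _ : ℕ ↦ I * V := by
    filter_upwards [eventually_ge_atTop 1] with K hK1 using (hK K hK1).symm
  have := tendsto_nhds_unique (hlim.congr' heq) hconst
  refine this.symm.trans ?_
  rw [hRes]

/-! ### The integrand on the horizontal half-lines `(−∞, 2] ± it` -/

/-- **Pointwise bound on the half-lines.** Let `x > 0`, `|t| ≥ 2`, `0 < η ≤ 1` with all non-trivial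
zeros `η`-away from the ordinate `t`, and
`Λ₀ ≥ C_r + 17 + 2 log|t| + C_h log(|t|+4)/η + M₀` (`M₀ = ∑ Λ(n) n^{−3/2}`). Then for every `σ`,
`‖(−ζ'/ζ)(σ+it) x^{σ+it}‖ ≤ (Λ₀ + 5 max(−σ,0)) x^σ` (the three regimes of
`ExplicitPsi.norm_integrand_horizontal_le`, without the factor `1/|s|`). [cite: MontgomeryVaughan2007, Thm. 12.5 (proof)] -/
theorem norm_integrand_horizontal_le_cpow {Cr Ch : ℝ}
    (hCr : ∀ s : ℂ, 3 / 2 ≤ s.re →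
      ‖logDeriv riemannXi s‖ ≤ Cr + ‖s‖ ∧
        (1 ≤ |s.im| → ‖logDeriv riemannXi s‖ ≤ Cr + Real.log (1 + ‖s‖)))
    (hCh : ∀ (t η : ℝ), 2 ≤ |t| → 0 < η → η ≤ 1 →
      (∀ ρ ∈ RHWave0.riemannZetaNontrivialZeros, η ≤ |ρ.im - t|) →
      ∀ σ : ℝ, σ ∈ Icc (-(1 / 2) : ℝ) (3 / 2) →
        ‖deriv riemannZeta (σ + t * I) / riemannZeta (σ + t * I)‖ ≤ Ch * Real.log (|t| + 4) / η)
    {x t η Λ₀ : ℝ} (hx : 0 < x) (ht : 2 ≤ |t|) (hη : 0 < η) (hη1 : η ≤ 1)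
    (hZ : ∀ ρ ∈ RHWave0.riemannZetaNontrivialZeros, η ≤ |ρ.im - t|)
    (hΛ₀ : Cr + 17 + 2 * Real.log |t| + Ch * Real.log (|t| + 4) / η +
      ∑' n : ℕ, ‖LSeries.term (fun n ↦ (ArithmeticFunction.vonMangoldt n : ℂ)) (3 / 2 : ℂ) n‖ ≤ Λ₀)
    (hCh0 : 0 ≤ Ch) (hCr0 : 0 ≤ Cr) (σ : ℝ) :
    ‖(fun s : ℂ ↦ (-deriv riemannZeta s / riemannZeta s) * (x : ℂ) ^ s) ((σ : ℂ) + t * I)‖ ≤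
      (Λ₀ + 5 * max (-σ) 0) * x ^ σ := by
  have ht0 : t ≠ 0 := fun h ↦ by rw [h, abs_zero] at ht; linarith
  have hM₀0 : 0 ≤ ∑' n : ℕ, ‖LSeries.term (fun n ↦ (ArithmeticFunction.vonMangoldt n : ℂ)) (3 / 2 : ℂ) n‖ :=
    tsum_nonneg fun _ ↦ norm_nonneg _
  have hlogt : 0 ≤ Real.log |t| := Real.log_nonneg (by linarith)
  have hlog4 : 0 ≤ Real.log (|t| + 4) := Real.log_nonneg (by linarith)
  have hmax : 0 ≤ max (-σ) 0 := le_max_right _ _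
  have hCη : 0 ≤ Ch * Real.log (|t| + 4) / η := by positivity
  have hΛ₀0 : 0 ≤ Λ₀ := le_trans (by positivity) hΛ₀
  show ‖(-deriv riemannZeta ((σ : ℂ) + t * I) / riemannZeta ((σ : ℂ) + t * I)) *
      (x : ℂ) ^ ((σ : ℂ) + t * I)‖ ≤ _
  rw [norm_mul, neg_div, norm_neg, Complex.norm_cpow_eq_rpow_re_of_pos hx]
  have hre : (((σ : ℂ) + t * I)).re = σ := by simp
  rw [hre]
  refine mul_le_mul_of_nonneg_right ?_ (Real.rpow_nonneg hx.le _)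
  rcases le_or_gt σ (-(1 / 2)) with h1 | h1
  · have h := norm_logDeriv_riemannZeta_le_of_re_le_neg_half hCr h1 ht
    have : 5 * (-σ) ≤ 5 * max (-σ) 0 := by linarith [le_max_left (-σ) 0]
    linarith
  rcases le_or_gt σ (3 / 2) with h2 | h2
  · have h := hCh t η ht hη hη1 hZ σ ⟨h1.le, h2⟩
    linarith
  · have hs : 3 / 2 ≤ ((σ : ℂ) + t * I).re := by simp; linarith
    have hs1 : 1 < ((σ : ℂ) + t * I).re := by simp; linarith
    have h := ZetaZeroSum.norm_LSeries_vonMangoldt_le_of_re_ge hs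
    rw [ArithmeticFunction.LSeries_vonMangoldt_eq_deriv_riemannZeta_div hs1, neg_div, norm_neg] at h
    linarith

/-- Continuity of `σ ↦ (−ζ'/ζ)(σ+it) x^{σ+it}` at a good height `t`. [folklore] -/
theorem continuous_integrand_horizontal_cpow {x t η : ℝ} (hx : 0 < x) (ht : t ≠ 0) (hη : 0 < η)
    (hZ : ∀ ρ ∈ RHWave0.riemannZetaNontrivialZeros, η ≤ |ρ.im - t|) :
    Continuous fun σ : ℝ ↦
      (fun s : ℂ ↦ (-deriv riemannZeta s / riemannZeta s) * (x : ℂ) ^ s) ((σ : ℂ) + t * I) := by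
  refine continuous_iff_continuousAt.2 fun σ ↦ ?_
  set s : ℂ := (σ : ℂ) + t * I with hs
  have hζ : riemannZeta s ≠ 0 := riemannZeta_ne_zero_of_goodHeight ht hη hZ σ
  have hs1 : s ≠ 1 := fun h ↦ ht (by simpa [hs] using congrArg Complex.im h)
  have hd : DifferentiableAt ℂ (deriv riemannZeta) s :=
    (analyticOn_riemannZeta s (by simpa using hs1)).deriv.differentiableAt
  have h : ContinuousAt (fun s : ℂ ↦ (-deriv riemannZeta s / riemannZeta s) * (x : ℂ) ^ s) s :=
    ((hd.neg.div (differentiableAt_riemannZeta hs1) hζ).mul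
      ((differentiable_const_cpow hx) s)).continuousAt
  exact h.comp (f := fun σ : ℝ ↦ (σ : ℂ) + t * I) (Continuous.continuousAt (by fun_prop))

/-- **The horizontal half-lines.** Under the hypotheses of `norm_integrand_horizontal_le_cpow`, for
`x > 1` the integrand is integrable on `(−∞, 2] + it` and
`‖∫_{−∞}^{2} (−ζ'/ζ)(σ+it) x^{σ+it} dσ‖ ≤ x² (Λ₀/log x + 20/(e log² x))`
(majorant `Λ₀ x^σ + (10/(e log x)) x^{σ/2}`, `∫_{−∞}^{2} x^σ dσ = x²/log x`).
[cite: Gonek1993, Thm. 1 (proof)] -/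
theorem horizontal_integral_bound_cpow {Cr Ch : ℝ}
    (hCr : ∀ s : ℂ, 3 / 2 ≤ s.re →
      ‖logDeriv riemannXi s‖ ≤ Cr + ‖s‖ ∧
        (1 ≤ |s.im| → ‖logDeriv riemannXi s‖ ≤ Cr + Real.log (1 + ‖s‖)))
    (hCh : ∀ (t η : ℝ), 2 ≤ |t| → 0 < η → η ≤ 1 →
      (∀ ρ ∈ RHWave0.riemannZetaNontrivialZeros, η ≤ |ρ.im - t|) →
      ∀ σ : ℝ, σ ∈ Icc (-(1 / 2) : ℝ) (3 / 2) →
        ‖deriv riemannZeta (σ + t * I) / riemannZeta (σ + t * I)‖ ≤ Ch * Real.log (|t| + 4) / η)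
    {x t η Λ₀ : ℝ} (hx : 1 < x) (ht : 2 ≤ |t|) (hη : 0 < η)
    (hη1 : η ≤ 1) (hZ : ∀ ρ ∈ RHWave0.riemannZetaNontrivialZeros, η ≤ |ρ.im - t|)
    (hΛ₀ : Cr + 17 + 2 * Real.log |t| + Ch * Real.log (|t| + 4) / η +
      ∑' n : ℕ, ‖LSeries.term (fun n ↦ (ArithmeticFunction.vonMangoldt n : ℂ)) (3 / 2 : ℂ) n‖ ≤ Λ₀)
    (hCh0 : 0 ≤ Ch) (hCr0 : 0 ≤ Cr) :
    IntegrableOn (fun σ : ℝ ↦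
      (fun s : ℂ ↦ (-deriv riemannZeta s / riemannZeta s) * (x : ℂ) ^ s) ((σ : ℂ) + t * I))
      (Iic (2 : ℝ)) ∧
    ‖∫ σ in Iic (2 : ℝ),
        (fun s : ℂ ↦ (-deriv riemannZeta s / riemannZeta s) * (x : ℂ) ^ s) ((σ : ℂ) + t * I)‖ ≤
      x ^ 2 * (Λ₀ / Real.log x + 20 / (Real.exp 1 * Real.log x ^ 2)) := by
  have hx0 : 0 < x := by linarith
  have ht0 : t ≠ 0 := fun h ↦ by rw [h, abs_zero] at ht; linarith
  have hL0 : 0 < Real.log x := Real.log_pos hx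
  have hM₀0 : 0 ≤ ∑' n : ℕ, ‖LSeries.term (fun n ↦ (ArithmeticFunction.vonMangoldt n : ℂ)) (3 / 2 : ℂ) n‖ :=
    tsum_nonneg fun _ ↦ norm_nonneg _
  have hlogt : 0 ≤ Real.log |t| := Real.log_nonneg (by linarith)
  have hlog4 : 0 ≤ Real.log (|t| + 4) := Real.log_nonneg (by linarith)
  have hCη : 0 ≤ Ch * Real.log (|t| + 4) / η := by positivity
  have hΛ₀0 : 0 ≤ Λ₀ := le_trans (by positivity) hΛ₀
  set G : ℝ → ℂ := fun σ ↦
    (fun s : ℂ ↦ (-deriv riemannZeta s / riemannZeta s) * (x : ℂ) ^ s) ((σ : ℂ) + t * I) with hG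
  -- the majorant
  set m : ℝ → ℝ := fun σ ↦ Λ₀ * Real.exp (Real.log x * σ) +
    10 / (Real.exp 1 * Real.log x) * Real.exp (Real.log x / 2 * σ) with hm
  have hGm : ∀ σ : ℝ, ‖G σ‖ ≤ m σ := by
    intro σ
    have h := norm_integrand_horizontal_le_cpow hCr hCh hx0 ht hη hη1 hZ hΛ₀ hCh0 hCr0 σ
    refine h.trans ?_
    have hw := max_neg_mul_exp_le (σ := σ) hL0
    rw [hm]
    simp only
    rw [Real.rpow_def_of_pos hx0]
    nlinarith [Real.exp_pos (Real.log x * σ)]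
  have hGcont : Continuous G := continuous_integrand_horizontal_cpow hx0 ht0 hη hZ
  have h1 : IntegrableOn (fun σ : ℝ ↦ Real.exp (Real.log x * σ)) (Iic (2 : ℝ)) :=
    integrableOn_exp_mul_Iic hL0 2
  have h2 : IntegrableOn (fun σ : ℝ ↦ Real.exp (Real.log x / 2 * σ)) (Iic (2 : ℝ)) :=
    integrableOn_exp_mul_Iic (half_pos hL0) 2
  have hm_int : Integrable m (volume.restrict (Iic (2 : ℝ))) :=
    (h1.const_mul Λ₀).add (h2.const_mul _)
  have hG_int : IntegrableOn G (Iic (2 : ℝ)) :=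
    Integrable.mono' hm_int hGcont.aestronglyMeasurable (ae_of_all _ hGm)
  refine ⟨hG_int, ?_⟩
  -- the integral of the majorant
  have hint_m : ∫ σ in Iic (2 : ℝ), m σ = Λ₀ * (Real.exp (Real.log x * 2) / Real.log x) +
      10 / (Real.exp 1 * Real.log x) * (Real.exp (Real.log x / 2 * 2) / (Real.log x / 2)) := by
    rw [hm]
    simp only
    rw [MeasureTheory.integral_add (h1.const_mul Λ₀) (h2.const_mul _),
      MeasureTheory.integral_const_mul, MeasureTheory.integral_const_mul,
      integral_exp_mul_Iic hL0, integral_exp_mul_Iic (half_pos hL0)]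
  have hex2 : Real.exp (Real.log x * 2) = x ^ 2 := by
    rw [show Real.log x * 2 = (2 : ℕ) * Real.log x by push_cast; ring, Real.exp_nat_mul, Real.exp_log hx0]
  have hex1 : Real.exp (Real.log x / 2 * 2) ≤ x ^ 2 := by
    rw [show Real.log x / 2 * 2 = Real.log x by ring, Real.exp_log hx0]
    nlinarith
  calc ‖∫ σ in Iic (2 : ℝ), G σ‖ ≤ ∫ σ in Iic (2 : ℝ), m σ :=
        norm_integral_le_of_norm_le hm_int (ae_of_all _ hGm)
    _ = Λ₀ * (Real.exp (Real.log x * 2) / Real.log x) +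
          10 / (Real.exp 1 * Real.log x) * (Real.exp (Real.log x / 2 * 2) / (Real.log x / 2)) := hint_m
    _ ≤ Λ₀ * (x ^ 2 / Real.log x) +
          10 / (Real.exp 1 * Real.log x) * (x ^ 2 / (Real.log x / 2)) := by
        rw [hex2]
        gcongr
    _ = x ^ 2 * (Λ₀ / Real.log x + 20 / (Real.exp 1 * Real.log x ^ 2)) := by
        field_simp
        ring

end LandauGonek

end Literature.NumberTheory.LFunctions

end
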